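import Literature.Topology.FourManifolds.InteriorManifold
import HarnessLib

/-!
# The interior of a connected manifold with corners is connected

Topic `Literature/Topology/FourManifolds` (general differential topology; brick [A1] of the
discharge of `Literature.Topology.FourManifolds.nonempty_diffeomorph_of_isOrientedConnectedSum` at
arbitrary models, see `ConnectedSumUniquenessProofs.lean`).

For a `C¹` manifold `M` modelled on a real model with corners `I : ModelWithCorners ℝ E H`
(Mathlib: `range I` is a closed convex subset of `E` with nonempty interior), the set
`I.interior M` of interior points is dense-and-locally-connected in the following strong sense:
every point of `M` has arbitrarily small open neighbourhoods `V` whose interior part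
`V ∩ I.interior M` is nonempty and preconnected — in a chart, `V` is the preimage of a small ball
`B` around the image point, and `V ∩ I.interior M` corresponds to `B ∩ interior (range I)`, a
nonempty convex set (`Literature.Topology.FourManifolds.exists_nhds_inter_interior_isPreconnected`).
Consequently the interior of a (pre)connected manifold is (pre)connected
(`Literature.Topology.FourManifolds.isPreconnected_interior`), and the boundaryless manifold
`Literature.Topology.FourManifolds.InteriorManifold I M` (`InteriorManifold.lean`) of a connected
`M` is a connected space (instance). This is the elementary half of Bröcker–Jänich,
*Introduction to Differential Topology* (1982), (13.3)–(13.4) (`M - ∂M` is an open dense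
submanifold; for classical corners it is connected when `M` is); the point-set lemma
`Literature.Topology.FourManifolds.isPreconnected_of_forall_nhds` isolates the argument: a subset
`S` of a preconnected space which is "locally nonempty and preconnected at every point of the
space" is preconnected.

Everything here is proved; there are no named facts. Mathlib has the invariance of the interior
under change of charts for `C¹` manifolds (`ModelWithCorners.isInteriorPoint_iff_of_mem_atlas`),
which is the only non-formal input.

## References

* T. Bröcker, K. Jänich, *Introduction to Differential Topology*, CUP (1982), §13, (13.3)–(13.4).
  [BrockerJanich1982]
-/

open scoped Manifold ContDiff Topology
open Set Function Filter

noncomputable section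

namespace Literature.Topology.FourManifolds

/-! ### A point-set lemma -/

section PointSet

variable {X : Type*} [TopologicalSpace X]

/-- **Local-to-global preconnectedness.** Let `S` be a subset of a preconnected space `X` such
that every point `x` of `X` (not only of `S`) has arbitrarily small neighbourhoods `V` with
`V ∩ S` nonempty and preconnected. Then `S` is preconnected. (If `S ⊆ u ∪ v` with `S ∩ u ∩ v = ∅`,
the sets of points near which `S` lies in `u`, resp. in `v`, are disjoint open sets covering `X`.)
[folklore] -/
theorem isPreconnected_of_forall_nhds [PreconnectedSpace X] {S : Set X}
    (h : ∀ x : X, ∀ U ∈ 𝓝 x, ∃ V ∈ 𝓝 x, V ⊆ U ∧ (V ∩ S).Nonempty ∧ IsPreconnected (V ∩ S)) :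
    IsPreconnected S := by
  rw [isPreconnected_iff_subset_of_disjoint]
  intro u v hu hv hSuv hdisj
  -- the points near which `S` lies inside `u`, resp. `v`
  set Wu : Set X := {x | ∃ V ∈ 𝓝 x, V ∩ S ⊆ u} with hWu_def
  set Wv : Set X := {x | ∃ V ∈ 𝓝 x, V ∩ S ⊆ v} with hWv_def
  have hWo : ∀ w : Set X, IsOpen {x | ∃ V ∈ 𝓝 x, V ∩ S ⊆ w} := fun w => by
    rw [isOpen_iff_mem_nhds]
    rintro x ⟨V, hV, hVw⟩
    filter_upwards [interior_mem_nhds.2 hV] with y hy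
    exact ⟨interior V, isOpen_interior.mem_nhds hy, (inter_subset_inter_left _ interior_subset).trans hVw⟩
  have hWuo : IsOpen Wu := hWo u
  have hWvo : IsOpen Wv := hWo v
  -- local dichotomy: near every point, `S` lies in `u` or in `v`
  have hcover : ∀ x, x ∈ Wu ∨ x ∈ Wv := fun x => by
    obtain ⟨V, hV, -, -, hVc⟩ := h x univ univ_mem
    have hVS : V ∩ S ⊆ u ∪ v := inter_subset_right.trans hSuv
    have hVd : V ∩ S ∩ (u ∩ v) = ∅ :=
      eq_empty_of_subset_empty ((inter_subset_inter_left _ inter_subset_right).trans hdisj.subset)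
    rcases (isPreconnected_iff_subset_of_disjoint.1 hVc) u v hu hv hVS hVd with hVu | hVv
    · exact Or.inl ⟨V, hV, hVu⟩
    · exact Or.inr ⟨V, hV, hVv⟩
  have hdisjW : ∀ x, x ∈ Wu → x ∈ Wv → False := fun x ⟨V₁, hV₁, h₁⟩ ⟨V₂, hV₂, h₂⟩ => by
    obtain ⟨V, hV, hVsub, ⟨y, hyV, hyS⟩, -⟩ := h x (V₁ ∩ V₂) (inter_mem hV₁ hV₂)
    have hyu : y ∈ u := h₁ ⟨(hVsub hyV).1, hyS⟩
    have hyv : y ∈ v := h₂ ⟨(hVsub hyV).2, hyS⟩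
    have : y ∈ S ∩ (u ∩ v) := ⟨hyS, hyu, hyv⟩
    rw [hdisj] at this
    exact this
  -- if both `S ∩ u` and `S ∩ v` were nonempty, `Wu`, `Wv` would disconnect `X`
  by_contra hcon
  push Not at hcon
  obtain ⟨hSu, hSv⟩ := hcon
  obtain ⟨a, haS, hau⟩ := nonempty_of_not_subset hSu
  obtain ⟨b, hbS, hbv⟩ := nonempty_of_not_subset hSv
  -- `a ∈ S ∖ u` lies in `v`, hence in `Wv`; `b ∈ S ∖ v` lies in `u`, hence in `Wu`
  have hav : a ∈ v := (hSuv haS).resolve_left hau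
  have hbu : b ∈ u := (hSuv hbS).resolve_right hbv
  have haW : a ∈ Wv := ⟨v, hv.mem_nhds hav, fun y hy => hy.1⟩
  have hbW : b ∈ Wu := ⟨u, hu.mem_nhds hbu, fun y hy => hy.1⟩
  have huniv : (univ : Set X) ⊆ Wu ∪ Wv := fun x _ => hcover x
  obtain ⟨x, -, hxu, hxv⟩ :=
    isPreconnected_univ Wu Wv hWuo hWvo huniv ⟨b, mem_univ _, hbW⟩ ⟨a, mem_univ _, haW⟩
  exact hdisjW x hxu hxv

end PointSet

/-! ### Charts: small neighbourhoods with convex interior part -/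

section Charts

variable {E H : Type*} [NormedAddCommGroup E] [NormedSpace ℝ E] [TopologicalSpace H]
  {I : ModelWithCorners ℝ E H} {M : Type*} [TopologicalSpace M] [ChartedSpace H M]
  [IsManifold I 1 M]

/-- In the preferred chart at `p`, a point `q` of the chart domain is an interior point of `M` iff
its image lies in the interior of `range I` (smooth invariance of the interior,
`ModelWithCorners.isInteriorPoint_iff_of_mem_atlas`). [folklore] -/
theorem isInteriorPoint_iff_extChartAt_mem_interior_range {p q : M}
    (hq : q ∈ (extChartAt I p).source) :
    I.IsInteriorPoint q ↔ extChartAt I p q ∈ interior (range I) := by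
  rw [extChartAt_source] at hq
  rw [I.isInteriorPoint_iff_of_mem_atlas (n := 1) one_ne_zero (chart_mem_atlas H p) hq, extChartAt]
  constructor
  · exact fun h => (chartAt H p).interior_extend_target_subset_interior_range h
  · intro h
    have h' : I (chartAt H p q) ∈ interior (range I) := by
      simpa [OpenPartialHomeomorph.extend_coe] using h
    simpa [OpenPartialHomeomorph.extend_coe] using
      (chartAt H p).mem_interior_extend_target ((chartAt H p).map_source hq) h'

/-- **Small chart neighbourhoods have nonempty convex interior part.** Every neighbourhood `U` of a
point `p` of a `C¹` manifold with (convex) corners contains an open neighbourhood `V` of `p` such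
that `V ∩ I.interior M` is nonempty and preconnected: `V` is the chart preimage of a small ball
`B` around the image of `p`, and `V ∩ I.interior M` is the chart preimage of the nonempty convex
set `B ∩ interior (range I)` (`range I` is convex with nonempty interior, so its interior is dense
in it). (Bröcker–Jänich (1982), (13.3): the interior is an open dense submanifold.) [folklore] -/
theorem exists_nhds_inter_interior_isPreconnected (p : M) {U : Set M} (hU : U ∈ 𝓝 p) :
    ∃ V ∈ 𝓝 p, V ⊆ U ∧ (V ∩ I.interior M).Nonempty ∧ IsPreconnected (V ∩ I.interior M) := by
  set e := extChartAt I p with he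
  set c : E := e p with hc
  -- a ball around `c` whose trace on `range I` lies in the target and in the preimage of `U`
  have h1 : e.target ∩ e.symm ⁻¹' U ∈ 𝓝[range I] c :=
    inter_mem (extChartAt_target_mem_nhdsWithin p)
      (mem_nhdsWithin_of_mem_nhds (extChartAt_preimage_mem_nhds hU))
  obtain ⟨ε, hε, hball⟩ := Metric.mem_nhdsWithin_iff.1 h1
  set V : Set M := e.source ∩ e ⁻¹' Metric.ball c ε with hV
  have hVo : IsOpen V :=
    (continuousOn_extChartAt p).isOpen_inter_preimage (isOpen_extChartAt_source p) Metric.isOpen_ball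
  have hpV : p ∈ V := ⟨mem_extChartAt_source p, Metric.mem_ball_self hε⟩
  -- description of the interior part of `V` in the chart
  set B : Set E := Metric.ball c ε ∩ interior (range I) with hB
  have hBtgt : B ⊆ e.target := fun u hu => (hball ⟨hu.1, interior_subset hu.2⟩).1
  have hVint : V ∩ I.interior M = e.symm '' B := by
    apply Subset.antisymm
    · rintro q ⟨⟨hqs, hqb⟩, hqi⟩
      refine ⟨e q, ⟨hqb, ?_⟩, e.left_inv hqs⟩
      exact (isInteriorPoint_iff_extChartAt_mem_interior_range hqs).1 hqi
    · rintro _ ⟨u, hu, rfl⟩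
      have hut : u ∈ e.target := hBtgt hu
      have hqs : e.symm u ∈ e.source := e.map_target hut
      have hequ : e (e.symm u) = u := e.right_inv hut
      refine ⟨⟨hqs, ?_⟩, ?_⟩
      · show e (e.symm u) ∈ Metric.ball c ε
        rw [hequ]; exact hu.1
      · show I.IsInteriorPoint (e.symm u)
        rw [isInteriorPoint_iff_extChartAt_mem_interior_range hqs, ← he, hequ]
        exact hu.2
  refine ⟨V, hVo.mem_nhds hpV, ?_, ?_, ?_⟩
  · -- `V ⊆ U`
    rintro q ⟨hqs, hqb⟩
    have hq : e q ∈ Metric.ball c ε ∩ range I := ⟨hqb, extChartAt_target_subset_range p (e.map_source hqs)⟩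
    have h := (hball hq).2
    simp only [mem_preimage] at h
    rwa [e.left_inv hqs] at h
  · -- nonempty: `c` lies in the closure of `interior (range I)`
    rw [hVint]
    refine (Nonempty.image _ ?_)
    have hcl : c ∈ closure (interior (range I)) := by
      rw [I.convex_range.closure_interior_eq_closure_of_nonempty_interior I.nonempty_interior]
      exact subset_closure (extChartAt_target_subset_range p (e.map_source (mem_extChartAt_source p)))
    obtain ⟨u, hu, hu'⟩ := Metric.mem_closure_iff.1 hcl ε hε
    exact ⟨u, Metric.mem_ball'.2 hu', hu⟩
  · -- preconnected: image of a convex set under the continuous inverse chart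
    rw [hVint]
    have hBc : Convex ℝ B := (convex_ball c ε).inter I.convex_range.interior
    exact hBc.isPreconnected.image _ ((continuousOn_extChartAt_symm p).mono hBtgt)

/-- **The interior of a preconnected `C¹` manifold with corners is preconnected**
(Bröcker–Jänich, *Introduction to Differential Topology* (1982), (13.3)–(13.4) for classical
corners; here for Mathlib's real models with convex range). [folklore] -/
theorem isPreconnected_interior [PreconnectedSpace M] : IsPreconnected (I.interior M) :=
  isPreconnected_of_forall_nhds fun p _ hU => exists_nhds_inter_interior_isPreconnected p hU

/-- The interior of a nonempty `C¹` manifold with corners is nonempty (it is dense). [folklore] -/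
theorem interior_nonempty [Nonempty M] : (I.interior M).Nonempty := by
  obtain ⟨p⟩ := ‹Nonempty M›
  obtain ⟨V, -, -, ⟨q, -, hq⟩, -⟩ :=
    exists_nhds_inter_interior_isPreconnected (I := I) p (univ_mem : (univ : Set M) ∈ 𝓝 p)
  exact ⟨q, hq⟩

/-- The interior of a `C¹` manifold with corners is dense. [folklore] -/
theorem dense_interior : Dense (I.interior M) := by
  intro p
  rw [mem_closure_iff_nhds]
  intro U hU
  obtain ⟨V, -, hVU, ⟨q, hqV, hq⟩, -⟩ := exists_nhds_inter_interior_isPreconnected (I := I) p hU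
  exact ⟨q, hVU hqV, hq⟩

end Charts

/-! ### The boundaryless interior manifold of a connected manifold is connected -/

namespace InteriorManifold

variable {E H : Type*} [NormedAddCommGroup E] [NormedSpace ℝ E] [TopologicalSpace H]
  {I : ModelWithCorners ℝ E H} {M : Type*} [TopologicalSpace M] [ChartedSpace H M]
  [IsManifold I ∞ M]

/-- The interior manifold of a nonempty manifold is nonempty. [folklore] -/
instance instNonempty [Nonempty M] : Nonempty (InteriorManifold I M) := by
  obtain ⟨q, hq⟩ := interior_nonempty (I := I) (M := M)
  exact ⟨⟨q, hq⟩⟩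

/-- The interior manifold of a preconnected manifold is preconnected. [folklore] -/
instance instPreconnectedSpace [PreconnectedSpace M] : PreconnectedSpace (InteriorManifold I M) := by
  constructor
  rw [← (isInducing_val (I := I) (M := M)).isPreconnected_image, image_univ, range_val]
  exact isPreconnected_interior

/-- **The interior of a connected manifold with corners is connected**: the boundaryless manifold
`InteriorManifold I M` of a connected `M` is a connected space (Bröcker–Jänich (1982),
(13.3)–(13.4)). [folklore] -/
instance instConnectedSpace [ConnectedSpace M] : ConnectedSpace (InteriorManifold I M) where
  toNonempty := inferInstance

end InteriorManifold

end Literature.Topology.FourManifolds
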